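import Summits.CriticalPhenomena.PercolationContinuityZ3.Theorems.PercNearOneGluingNoHeavyPcintWinKernelCert
import HarnessLib

/-!
# PCINT lane, kernel B2r window certificate `d = 6`, memory 4 (3-step windows, 1728 codes) — table and chunk check

Cell `prim-pcint`, seat `prim-pcint-2` (gen 2); memo `run/shared/lean/prim/pcint/REDUCTIONS.md` §B2r, INTERVAL-PLAN §14.
Does NOT build on p205010.  Instance data for the generic theorem
`WinK.le_siteCriticalProb_of_checkS`: `p = 995/10^4`, `q̄ = 9906/10^4` (`q̄^11 ≥ 1-p`), `κ̄ = (10^4+9906)/(2·10^4)`; Collatz–Wielandt vector on the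
5 hyperoctahedral normal forms (integer scale `10^5`, found by power iteration and verified in exact arithmetic
off-line: max row ratio `1998379761247/1999140000000` < 1; `λ = 99999/10^5`).  The `1728` coded rows are checked by `decide +kernel` in
`…KernZ6S4Check*`; result in `…KernZ6S4`: `p_c^site(ℤ⁶) ≥ 0.0995`.
-/

namespace Summit.CriticalPhenomena.PercolationContinuityZ3.Theorems.Pcint

namespace Z6S4

/-- The certificate table `normal-form code ↦ v`. [folklore] -/
def tbl : List (ℕ × ℕ) := [(0, 100000), (24, 90891), (288, 90891), (312, 99957), (600, 90764)]

/-- All table values lie in `[90764, 100000]`. [folklore] -/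
theorem tbl_bounds : ∀ e ∈ tbl, 90764 ≤ e.2 ∧ e.2 ≤ 100000 := by decide

/-- The Collatz–Wielandt row check on the window codes `[lo, hi)`. [folklore] -/
def chk (lo hi : ℕ) : Bool := WinK.allRange (WinK.rowOKS 6 2 995 9906 99999 tbl 90764) lo hi

/-- Splitting a chunk check. [folklore] -/
theorem chk_split {lo mid hi : ℕ} (h1 : chk lo mid = true) (h2 : chk mid hi = true) : chk lo hi = true :=
  WinK.allRange_split h1 h2

end Z6S4

end Summit.CriticalPhenomena.PercolationContinuityZ3.Theorems.Pcint
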